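import Mathlib
import Literature.AlgebraicGeometry.Resolution.BlowupsComposition
import Summits.ResolutionOfSingularities.ResolutionOfSingularities.Theorems.WildQuotientsWildQuotientResolutionBlowupExitCoverEngine
import Summits.ResolutionOfSingularities.ResolutionOfSingularities.Theorems.WildQuotientsWildQuotientResolutionJordanFiveCoverMemberships
import Summits.ResolutionOfSingularities.ResolutionOfSingularities.Theorems.WildQuotientsWildQuotientResolutionJordanFiveCoverInjective
import Summits.ResolutionOfSingularities.ResolutionOfSingularities.Theorems.WildQuotientsWildQuotientResolutionJordanFiveMu2CoverSubst
import Summits.ResolutionOfSingularities.ResolutionOfSingularities.Theorems.WildQuotientsWildQuotientResolutionJordanFiveMu2CoverEven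
import Summits.ResolutionOfSingularities.ResolutionOfSingularities.Theorems.WildQuotientsWildQuotientResolutionJordanFiveMu2CoverAction
import Summits.ResolutionOfSingularities.ResolutionOfSingularities.Theorems.WildQuotientsWildQuotientResolutionJordanFiveMu2CoverActionExists
import Summits.ResolutionOfSingularities.ResolutionOfSingularities.Theorems.WildQuotientsWildQuotientResolutionJordanFourChartTTwisted

/-!
# RUNG V5 (`J₅`), brick B7/HP₂ (W₂-A): `Γ(W₂) = (k[x][I₁₂t])_{(i₂³t·(2j₃)²t)}` IS the deck-invariant ring `U₂^{⟨τ⟩}` of the twisted-root cover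
(crux stmt-ResolutionOfSingularities-15640 `WildQuotients.WildQuotientResolution`, line `Sketch`;
chain w45c RUNG V5, res-L1-w45c-plan-1 ORDER 2026-08-27T14:10:40Z / RULING 14:29:53Z (W₂-A);
written by res-D-pv-033 AS res-L1-w45c-stub-5 on res-type-036's cover letters. [OURS · L1 W4.5c]
— NOT a statement of any manuscript; replaces the role of no printed item.)

**`JordanFive.exists_chartW₂_away_ringEquiv_fixedTau`.**  For `U` any localisation of
`k[s,Y,pass] ⧸ (Φ)` away from `î` (the cover `U₂` of `W₂`, design W2-DESIGN §6 of res-L1-w45c-idea-2)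
and ANY `k`-automorphism `τ_U` with the deck laws `s, Y_b, Y_d ↦ −s, −Y_b, −Y_d` (other variables
fixed), `2, 3 ≠ 0`:
`eE : (k[x][I₁₂t])_{(i₂³t·(2j₃)²t)} ≃+* U^{⟨τ_U⟩}` with `eE (F/1) = π(coverSubst F)` — the `eE`/`hbase`
input of res-type-036's model brick `exists_ringBrick_HP2_model` (p540201).
Assembly of the cover engine `BlowupExit.exists_ringEquiv_subalgebra_of_coverData` (p539340) at
`T = i₂³`, `G = (2j₃)²`, `β = π ∘ coverSubst` (injective, p540552; `βT·βG ≠ 0`), `S = U^{⟨τ_U⟩}`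
(`β(k[x]) ⊆ S` by 036's `coverTau_apply_algebraMap_coverSubst`; chart ratios `u_j = s^{wt_j−12}Y^{α_j}/î³`
— invariant for free: `u_j·βT = βg_j` with `βT` a non-zero-divisor; `θ⁻¹ = î/4`), generators = 036's
`fixedPoints_coverTau_eq_adjoin` (p538482), and the DICTIONARY (`θ = βG/βT = 4/î`):
`s² = −½(2j₃)i₂²/i₂³`, `sY_b = [−2x_b i₂(2j₃)/i₂³]θ⁻¹`, `sY_d = x_d`, `Y_b² = [−8x_b²(2j₃)/i₂³]θ⁻²`,
`Y_bY_d = [4x_bx_d i₂²/i₂³]θ⁻¹`, `Y_d² = [−2x_d² i₂(2j₃)/i₂³]θ⁻¹`, `Y_a = [4x_a i₂²/i₂³]θ⁻¹`,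
`Y_c = [−2x_c i₂(2j₃)/i₂³]θ⁻¹`, `Y_i = x_i` (`i ∉ {a,b,c,d}`), `1/î = ¼θ` (memberships p539864).
-/

-- single-problem summit: the doubled namespace component `ResolutionOfSingularities` is forced
set_option linter.dupNamespace false

noncomputable section

open MvPolynomial HomogeneousLocalization Literature.AlgebraicGeometry.Resolution
open Summit.ResolutionOfSingularities.ResolutionOfSingularities.Theorems.WildQuotientResolution.TameTransfer

namespace Summit.ResolutionOfSingularities.ResolutionOfSingularities.Theorems.WildQuotientResolution.JordanFive

variable (k : Type) [Field k] (n : ℕ) (a b c d e : Fin n)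
  (hab : a ≠ b) (hac : a ≠ c) (had : a ≠ d) (hae : a ≠ e) (hbc : b ≠ c) (hbd : b ≠ d)
  (hbe : b ≠ e) (hcd : c ≠ d) (hce : c ≠ e) (hde : d ≠ e)
  (I : Ideal (MvPolynomial (Option (Fin n)) k)) (ι : MvPolynomial (Option (Fin n)) k)
  (hI : I = Ideal.span {coverPhi (X none) (X (some a)) (X (some b)) (X (some c)) (X (some d))
    (X (some e) : MvPolynomial (Option (Fin n)) k)})
  (hι : ι = coverIHat (X none) (X (some a)) (X (some b)) (X (some c)) (X (some d)) (X (some e)))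
  (U : Type) [CommRing U] [Algebra (MvPolynomial (Option (Fin n)) k ⧸ I) U]
  [IsLocalization.Away (Ideal.Quotient.mk I ι) U] [Algebra k U]
  [IsScalarTower k (MvPolynomial (Option (Fin n)) k ⧸ I) U]

include hab hac had hae hbc hbd hbe hcd hce hde hI hι in
-- one assembly over the cover engine with a nine-entry dictionary: head-room for the bookkeeping
set_option maxHeartbeats 3200000 in
/-- **`Γ(W₂) ≃ U^{⟨τ_U⟩}` through the cover substitution** (see the module docstring).
[OURS · L1 W4.5c] [folklore; assembly of landed decls] -/
theorem exists_chartW₂_away_ringEquiv_fixedTau (h2 : (2 : k) ≠ 0) (h3 : (3 : k) ≠ 0)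
    (τU : U ≃ₐ[k] U)
    (τs : τU (algebraMap _ U (Ideal.Quotient.mk I (X none))) =
      -algebraMap _ U (Ideal.Quotient.mk I (X none)))
    (τb : τU (algebraMap _ U (Ideal.Quotient.mk I (X (some b)))) =
      -algebraMap _ U (Ideal.Quotient.mk I (X (some b))))
    (τd : τU (algebraMap _ U (Ideal.Quotient.mk I (X (some d)))) =
      -algebraMap _ U (Ideal.Quotient.mk I (X (some d))))
    (τi : ∀ i, i ≠ b → i ≠ d → τU (algebraMap _ U (Ideal.Quotient.mk I (X (some i)))) =
      algebraMap _ U (Ideal.Quotient.mk I (X (some i)))) :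
    ∃ eE : HomogeneousLocalization.Away (reesGrading (I12 k n a b c d))
        (reesT (iTwo k n a b c d e ^ 3) (iTwo_cube_mem_I12 k n a b c d e) *
          reesT (jThreeTwo k n a b c d e ^ 2) (jThreeTwo_sq_mem_I12 k n a b c d e)) ≃+*
        ↥(FixedPoints.subalgebra k U (Subgroup.zpowers τU)),
      ∀ F : MvPolynomial (Fin n) k,
        ((eE ((HomogeneousLocalization.fromZeroRingHom (reesGrading (I12 k n a b c d)) _).comp
          (reesGrading.zeroRingHom (I12 k n a b c d)) F) :
            FixedPoints.subalgebra k U (Subgroup.zpowers τU)) : U) =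
          algebraMap _ U (Ideal.Quotient.mk I (coverSubst k n a b c d F)) := by
  classical
  -- ### the cover as a domain
  haveI : IsDomain (MvPolynomial (Option (Fin n)) k ⧸ I) := by
    rw [hI]; exact isDomain_quotient_coverPhi k n a b c d e hab hac hae hbc hbe hce hde h2 h3
  have hιI : ι ∉ I := by
    rw [hI, hι]; exact coverIHat_notMem_span_coverPhi k n a b c d e hac hbc hcd hce
  haveI : IsDomain U := away_quotient_isDomain k n I ι U hιI
  -- ### `π`, `β` and the atoms
  set πU : MvPolynomial (Option (Fin n)) k →+* U :=
    (algebraMap (MvPolynomial (Option (Fin n)) k ⧸ I) U).comp (Ideal.Quotient.mk I) with hπU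
  have hπ : ∀ x, algebraMap _ U (Ideal.Quotient.mk I x) = πU x := fun x => rfl
  let β : MvPolynomial (Fin n) k →ₐ[k] U :=
    ((IsScalarTower.toAlgHom k (MvPolynomial (Option (Fin n)) k ⧸ I) U).comp
      (Ideal.Quotient.mkₐ k I)).comp (coverSubst k n a b c d)
  have hβ : ∀ F, β F = πU (coverSubst k n a b c d F) := fun F => rfl
  set S : U := πU (X none) with hS
  set A : U := πU (coverIHat (X none) (X (some a)) (X (some b)) (X (some c)) (X (some d))
    (X (some e))) with hA
  set Ai : U := IsLocalization.Away.invSelf (S := U) (Ideal.Quotient.mk I ι) with hAi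
  have hιA : πU ι = A := by rw [hA, hι]
  have hAAi : A * Ai = 1 := by
    rw [← hιA]; exact IsLocalization.Away.mul_invSelf (S := U) (Ideal.Quotient.mk I ι)
  have hC : ∀ r : k, πU (C r) = algebraMap k U r := fun r => algebraMap_mk_C k n I U r
  set q2 : U := algebraMap k U 2⁻¹ with hq2
  set q4 : U := algebraMap k U 4⁻¹ with hq4
  have h4 : (4 : k) ≠ 0 := by
    have : (4 : k) = 2 ^ 2 := by norm_num
    rw [this]; exact pow_ne_zero 2 h2
  have hq2' : q2 * 2 = 1 := by
    rw [hq2, ← map_ofNat (algebraMap k U) 2, ← map_mul, inv_mul_cancel₀ h2, map_one]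
  have hq4' : q4 * 4 = 1 := by
    rw [hq4, ← map_ofNat (algebraMap k U) 4, ← map_mul, inv_mul_cancel₀ h4, map_one]
  -- ### the cover relation `ĵ = −2 î` in `U`
  have hΦ : πU (coverPhi (X none) (X (some a)) (X (some b)) (X (some c)) (X (some d))
      (X (some e))) = 0 := by
    rw [← hπ, Ideal.Quotient.eq_zero_iff_mem.mpr (by rw [hI]; exact Ideal.mem_span_singleton_self _),
      map_zero]
  have hJ : πU (coverJHat (X none) (X (some a)) (X (some b)) (X (some c)) (X (some d))
      (X (some e))) = -2 * A := by
    rw [coverPhi_def, map_add, map_mul, map_ofNat] at hΦ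
    linear_combination hΦ
  -- ### values of `β`
  have hT1 : πU (coverSubst k n a b c d (iTwo k n a b c d e)) = S ^ 4 * A := by
    rw [coverSubst_iTwo k n a b c d e hab hac had hae hbc hbd hbe hcd hce hde, map_mul, map_pow]
  have hG1 : πU (coverSubst k n a b c d (jThreeTwo k n a b c d e)) = -2 * S ^ 6 * A := by
    rw [coverSubst_jThreeTwo k n a b c d e hab hac had hae hbc hbd hbe hcd hce hde, map_mul, map_pow,
      hJ]; ring
  have hβT : β (iTwo k n a b c d e ^ 3) = (S ^ 4 * A) ^ 3 := by rw [hβ, map_pow, map_pow, hT1]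
  have hβG : β (jThreeTwo k n a b c d e ^ 2) = (-2 * S ^ 6 * A) ^ 2 := by
    rw [hβ, map_pow, map_pow, hG1]
  have hβa : β (X a) = S ^ 4 * πU (X (some a)) := by rw [hβ, coverSubst_X_a, map_mul, map_pow]
  have hβb : β (X b) = S ^ 3 * πU (X (some b)) := by
    rw [hβ, coverSubst_X_b k n a b c d hab, map_mul, map_pow]
  have hβc : β (X c) = S ^ 2 * πU (X (some c)) := by
    rw [hβ, coverSubst_X_c k n a b c d hac hbc, map_mul, map_pow]
  have hβd : β (X d) = S * πU (X (some d)) := by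
    rw [hβ, coverSubst_X_d k n a b c d had hbd hcd, map_mul]
  have hβi : ∀ i, i ≠ a → i ≠ b → i ≠ c → i ≠ d → β (X i) = πU (X (some i)) := fun i hia hib hic hid => by
    rw [hβ, coverSubst_X_of_ne k n a b c d i hia hib hic hid]
  have hβC : ∀ r : k, β (C r) = algebraMap k U r := fun r => by rw [hβ, coverSubst_C, hC]
  have hβi2 : β (iTwo k n a b c d e) = S ^ 4 * A := by rw [hβ, hT1]
  have hβj3 : β (jThreeTwo k n a b c d e) = -2 * S ^ 6 * A := by rw [hβ, hG1]
  -- ### injectivity and the non-zero-divisor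
  have hβinj : Function.Injective β :=
    coverSubst_algebraMap_injective k n a b c d e hab hac had hae hbc hbd hbe hcd hce hde I ι hI hι U h2
  have hne : β (iTwo k n a b c d e ^ 3) * β (jThreeTwo k n a b c d e ^ 2) ≠ 0 :=
    coverSubst_algebraMap_iTwo_jThreeTwo_ne_zero k n a b c d e hab hac had hae hbc hbd hbe hcd hce hde
      I ι hI hι U h2 h3
  have hnzd : β (iTwo k n a b c d e ^ 3) * β (jThreeTwo k n a b c d e ^ 2) ∈ nonZeroDivisors U :=
    mem_nonZeroDivisors_of_ne_zero hne
  have hTne : β (iTwo k n a b c d e ^ 3) ≠ 0 := left_ne_zero_of_mul hne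
  -- ### the deck involution on polynomials and `τ_U ∘ π = π ∘ τ_A`
  obtain ⟨τA, hτAs, hτAb, hτAd, hτAi, -⟩ := exists_coverTau k n b d
  have hτU : ∀ o, τU (algebraMap _ U (Ideal.Quotient.mk I (X o))) =
      algebraMap _ U (Ideal.Quotient.mk I (τA (X o))) := by
    intro o
    rcases o with _ | i
    · rw [τs, hτAs, map_neg, map_neg]
    · by_cases hib : i = b
      · subst hib; rw [τb, hτAb, map_neg, map_neg]
      by_cases hid : i = d
      · subst hid; rw [τd, hτAd, map_neg, map_neg]
      · rw [τi i hib hid, hτAi i hib hid]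
  have hιU : τU (algebraMap _ U (Ideal.Quotient.mk I ι)) = algebraMap _ U (Ideal.Quotient.mk I ι) := by
    rw [cover_apply_algebraMap_mk k n I U τU τA hτU, hι,
      coverTau_apply_coverIHat k n a b c d e hab had τA hτAs hτAb hτAd hτAi hbc hcd hbe hde]
  -- ### the invariant subalgebra `S = U^{⟨τ_U⟩}` and its known members
  set Fix : Subalgebra k U := FixedPoints.subalgebra k U (Subgroup.zpowers τU) with hFix
  have hmem : ∀ u : U, u ∈ Fix ↔ τU u = u := fun u => mem_fixedPoints_zpowers_iff_apply_eq τU u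
  have hβS : ∀ r, β r ∈ Fix := fun r => (hmem _).mpr (by
    rw [hβ, ← hπ]
    exact coverTau_apply_algebraMap_coverSubst k n a b c d hab hac had hbc hbd hcd I U τU τA hτAs hτAb
      hτAd hτAi hτU r)
  have hAS : A ∈ Fix := (hmem _).mpr (by rw [← hιA, ← hπ]; exact hιU)
  have hle := adjoin_even_le_fixedPoints k n b d I ι U τU τs τb τd τi hιU
  have hAiS : Ai ∈ Fix := hle (Algebra.subset_adjoin (Or.inr rfl))
  have hgens := (fixedPoints_coverTau_eq_adjoin k n b d I ι U τU τs τb τd τi hιU h2).le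
  -- invariance for free: `u·βT = βx` forces `τ u = u`
  have hfree : ∀ (u : U) (x : MvPolynomial (Fin n) k), u * β (iTwo k n a b c d e ^ 3) = β x → u ∈ Fix := by
    intro u x hu
    rw [hmem]
    apply mul_right_cancel₀ hTne
    have h1 : τU (β (iTwo k n a b c d e ^ 3)) = β (iTwo k n a b c d e ^ 3) := (hmem _).mp (hβS _)
    have h2' : τU (β x) = β x := (hmem _).mp (hβS _)
    rw [hu, ← h2', ← hu, map_mul, h1]
  -- ### the chart ratios
  have hwt : ∀ j : Fin 40,
      12 ≤ 4 * (exps12 j).1 + 3 * (exps12 j).2.1 + 2 * (exps12 j).2.2.1 + (exps12 j).2.2.2 := by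
    intro j; fin_cases j <;> simp [exps12]
  have hgen1 : ∀ j : Fin 40, ∃ u ∈ Fix, u * β (iTwo k n a b c d e ^ 3) = β (gens12 k n a b c d j) := by
    intro j
    obtain ⟨m, hm⟩ : ∃ m, 4 * (exps12 j).1 + 3 * (exps12 j).2.1 + 2 * (exps12 j).2.2.1 +
        (exps12 j).2.2.2 = m + 12 := ⟨_, (Nat.sub_add_cancel (hwt j)).symm⟩
    set mono : MvPolynomial (Option (Fin n)) k := X (some a) ^ (exps12 j).1 *
      X (some b) ^ (exps12 j).2.1 * X (some c) ^ (exps12 j).2.2.1 * X (some d) ^ (exps12 j).2.2.2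
      with hmono
    have hPQ : (X none : MvPolynomial (Option (Fin n)) k) ^ (m + 12) *
        (X (some a) ^ (exps12 j).1 * X (some b) ^ (exps12 j).2.1 * X (some c) ^ (exps12 j).2.2.1 *
          X (some d) ^ (exps12 j).2.2.2) = (X none ^ m * mono) * X none ^ 12 := by
      rw [hmono]; ring
    have hgj : β (gens12 k n a b c d j) = πU (X none ^ m * mono) * S ^ 12 := by
      rw [hβ, coverSubst_gens12 k n a b c d hab hac had hbc hbd hcd j, hm, hPQ, map_mul, map_pow, ← hS]
    have hu : πU (X none ^ m * mono) * Ai ^ 3 * β (iTwo k n a b c d e ^ 3) = β (gens12 k n a b c d j) := by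
      rw [hgj, hβT]
      calc πU (X none ^ m * mono) * Ai ^ 3 * (S ^ 4 * A) ^ 3
          = πU (X none ^ m * mono) * S ^ 12 * (A * Ai) ^ 3 := by ring
        _ = πU (X none ^ m * mono) * S ^ 12 := by rw [hAAi, one_pow, mul_one]
    exact ⟨πU (X none ^ m * mono) * Ai ^ 3, hfree _ _ hu, hu⟩
  have hgen : ∀ x ∈ I12 k n a b c d, ∃ u ∈ Fix, u * β (iTwo k n a b c d e ^ 3) = β x := by
    intro x hx
    refine Submodule.span_induction (p := fun x _ => ∃ u ∈ Fix, u * β (iTwo k n a b c d e ^ 3) = β x)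
      ?_ ?_ ?_ ?_ hx
    · rintro _ ⟨j, rfl⟩
      exact hgen1 j
    · exact ⟨0, Subalgebra.zero_mem _, by rw [zero_mul, map_zero]⟩
    · rintro x y - - ⟨u₁, hu₁, h₁⟩ ⟨u₂, hu₂, h₂⟩
      exact ⟨u₁ + u₂, Subalgebra.add_mem _ hu₁ hu₂, by rw [add_mul, h₁, h₂, map_add]⟩
    · rintro r x - ⟨u, hu, h⟩
      exact ⟨β r * u, Subalgebra.mul_mem _ (hβS r) hu, by rw [smul_eq_mul, map_mul, mul_assoc, h]⟩
  -- ### `θ⁻¹ = î/4`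
  have hinv : ∃ v ∈ Fix, v * β (jThreeTwo k n a b c d e ^ 2) = β (iTwo k n a b c d e ^ 3) := by
    refine ⟨q4 * A, Subalgebra.mul_mem _ (Subalgebra.algebraMap_mem _ _) hAS, ?_⟩
    rw [hβG, hβT]
    linear_combination (S ^ 12 * A ^ 3) * hq4'
  -- ### memberships `F ∈ I₁₂ ^ μ`
  have hI1 : ∀ {F : MvPolynomial (Fin n) k}, F ∈ I12 k n a b c d → F ∈ I12 k n a b c d ^ 1 :=
    fun hF => by rw [pow_one]; exact hF
  have hI0 : ∀ F : MvPolynomial (Fin n) k, F ∈ I12 k n a b c d ^ 0 := fun F => by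
    rw [pow_zero, Ideal.one_eq_top]; exact Submodule.mem_top
  -- ### the dictionary
  have hdict : ∀ t ∈ ((fun x => algebraMap _ U (Ideal.Quotient.mk I x)) ''
        ({X none ^ 2, X none * X (some b), X none * X (some d), X (some b) ^ 2,
          X (some b) * X (some d), X (some d) ^ 2} ∪
          Set.range (fun i : {i : Fin n // i ≠ b ∧ i ≠ d} => X (some i.1))) ∪
        {IsLocalization.Away.invSelf (Ideal.Quotient.mk I ι)}),
      ∃ (μ e₁ e' : ℕ) (F : MvPolynomial (Fin n) k), F ∈ I12 k n a b c d ^ μ ∧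
        t * β (iTwo k n a b c d e ^ 3) ^ (μ + e₁) * β (jThreeTwo k n a b c d e ^ 2) ^ e' =
          β F * β (jThreeTwo k n a b c d e ^ 2) ^ e₁ * β (iTwo k n a b c d e ^ 3) ^ e' := by
    rintro t (⟨g, hg, rfl⟩ | ht)
    · change ∃ (μ e₁ e' : ℕ) (F : MvPolynomial (Fin n) k), F ∈ I12 k n a b c d ^ μ ∧
        πU g * β (iTwo k n a b c d e ^ 3) ^ (μ + e₁) * β (jThreeTwo k n a b c d e ^ 2) ^ e' =
          β F * β (jThreeTwo k n a b c d e ^ 2) ^ e₁ * β (iTwo k n a b c d e ^ 3) ^ e'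
      rcases hg with hg | ⟨i, rfl⟩
      · simp only [Set.mem_insert_iff, Set.mem_singleton_iff] at hg
        rcases hg with rfl | rfl | rfl | rfl | rfl | rfl
        · -- `s² = −½ · (2j₃) i₂² / i₂³`
          refine ⟨1, 0, 0, C (2⁻¹ : k) * -(iTwo k n a b c d e ^ 2 * jThreeTwo k n a b c d e),
            hI1 (Ideal.mul_mem_left _ _ (Submodule.neg_mem _
              (iTwo_sq_jThreeTwo_mem_I12 k n a b c d e))), ?_⟩
          simp only [map_mul, map_pow, map_neg, hβi2, hβj3, hβC, ← hS, ← hq2]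
          linear_combination (-(S ^ 14 * A ^ 3)) * hq2'
        · -- `s Y_b = [−2 x_b i₂ (2j₃) / i₂³] · θ⁻¹`
          refine ⟨1, 0, 1, -2 * (X b * iTwo k n a b c d e * jThreeTwo k n a b c d e),
            hI1 (Ideal.mul_mem_left _ _ (xb_iTwo_jThreeTwo_mem_I12 k n a b c d e)), ?_⟩
          simp only [map_mul, map_pow, map_neg, map_ofNat, hβb, hβi2, hβj3, ← hS]
          ring
        · -- `s Y_d = x_d`
          refine ⟨0, 0, 0, X d, hI0 _, ?_⟩
          simp only [map_mul, map_pow, hβd, hβi2, hβj3, ← hS]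
          ring
        · -- `Y_b² = [−8 x_b² (2j₃) / i₂³] · θ⁻²`
          refine ⟨1, 0, 2, -8 * (X b ^ 2 * jThreeTwo k n a b c d e),
            hI1 (Ideal.mul_mem_left _ _ (xb_sq_jThreeTwo_mem_I12 k n a b c d e)), ?_⟩
          simp only [map_mul, map_pow, map_neg, map_ofNat, hβb, hβi2, hβj3]
          ring
        · -- `Y_b Y_d = [4 x_b x_d i₂² / i₂³] · θ⁻¹`
          refine ⟨1, 0, 1, 4 * (X b * X d * iTwo k n a b c d e ^ 2),
            hI1 (Ideal.mul_mem_left _ _ (xb_xd_iTwo_sq_mem_I12 k n a b c d e)), ?_⟩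
          simp only [map_mul, map_pow, map_ofNat, hβb, hβd, hβi2, hβj3]
          ring
        · -- `Y_d² = [−2 x_d² i₂ (2j₃) / i₂³] · θ⁻¹`
          refine ⟨1, 0, 1, -2 * (X d ^ 2 * iTwo k n a b c d e * jThreeTwo k n a b c d e),
            hI1 (Ideal.mul_mem_left _ _ (xd_sq_iTwo_jThreeTwo_mem_I12 k n a b c d e)), ?_⟩
          simp only [map_mul, map_pow, map_neg, map_ofNat, hβd, hβi2, hβj3]
          ring
      · -- the even variables `Y_i`, `i ∉ {b, d}`
        obtain ⟨i, hib, hid⟩ := i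
        change ∃ (μ e₁ e' : ℕ) (F : MvPolynomial (Fin n) k), F ∈ I12 k n a b c d ^ μ ∧
          πU (X (some i)) * β (iTwo k n a b c d e ^ 3) ^ (μ + e₁) * β (jThreeTwo k n a b c d e ^ 2) ^ e' =
            β F * β (jThreeTwo k n a b c d e ^ 2) ^ e₁ * β (iTwo k n a b c d e ^ 3) ^ e'
        by_cases hia : i = a
        · -- `Y_a = [4 x_a i₂² / i₂³] · θ⁻¹`
          subst hia
          refine ⟨1, 0, 1, 4 * (X i * iTwo k n i b c d e ^ 2),
            hI1 (Ideal.mul_mem_left _ _ (xa_iTwo_sq_mem_I12 k n i b c d e)), ?_⟩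
          simp only [map_mul, map_pow, map_ofNat, hβa, hβi2, hβj3]
          ring
        by_cases hic : i = c
        · -- `Y_c = [−2 x_c i₂ (2j₃) / i₂³] · θ⁻¹`
          subst hic
          refine ⟨1, 0, 1, -2 * (X i * iTwo k n a b i d e * jThreeTwo k n a b i d e),
            hI1 (Ideal.mul_mem_left _ _ (xc_iTwo_jThreeTwo_mem_I12 k n a b i d e)), ?_⟩
          simp only [map_mul, map_pow, map_neg, map_ofNat, hβc, hβi2, hβj3]
          ring
        · -- a passenger (or `Y_e`): `Y_i = x_i`
          refine ⟨0, 0, 0, X i, hI0 _, ?_⟩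
          rw [hβi i hia hib hic hid]
          simp only [map_pow, hβi2, hβj3]
          ring
    · -- `1/î = ¼ θ`
      rw [Set.mem_singleton_iff] at ht
      subst ht
      refine ⟨0, 1, 0, C (4⁻¹ : k), hI0 _, ?_⟩
      rw [← hAi]
      simp only [map_pow, hβi2, hβj3, hβC, ← hq4]
      linear_combination (S ^ 12 * A ^ 2) * hAAi - (S ^ 12 * A ^ 2) * hq4'
  -- ### the chart ring as a localisation of `B₂ = (k[x][I₁₂t])_{(i₂³t)}` at `θ = ((2j₃)²t)/(i₂³t)`
  letI instAlg := (HomogeneousLocalization.awayMap (reesGrading (I12 k n a b c d))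
    (reesT_mem (jThreeTwo k n a b c d e ^ 2) (jThreeTwo_sq_mem_I12 k n a b c d e))
    (rfl : reesT (iTwo k n a b c d e ^ 3) (iTwo_cube_mem_I12 k n a b c d e) *
      reesT (jThreeTwo k n a b c d e ^ 2) (jThreeTwo_sq_mem_I12 k n a b c d e) = _)).toAlgebra
  haveI : IsLocalization.Away (HomogeneousLocalization.Away.isLocalizationElem
      (𝒜 := reesGrading (I12 k n a b c d))
      (reesT_mem (iTwo k n a b c d e ^ 3) (iTwo_cube_mem_I12 k n a b c d e))
      (reesT_mem (jThreeTwo k n a b c d e ^ 2) (jThreeTwo_sq_mem_I12 k n a b c d e)))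
      (HomogeneousLocalization.Away (reesGrading (I12 k n a b c d))
        (reesT (iTwo k n a b c d e ^ 3) (iTwo_cube_mem_I12 k n a b c d e) *
          reesT (jThreeTwo k n a b c d e ^ 2) (jThreeTwo_sq_mem_I12 k n a b c d e))) :=
    HomogeneousLocalization.Away.isLocalization_mul (𝒜 := reesGrading (I12 k n a b c d))
      (reesT_mem (iTwo k n a b c d e ^ 3) (iTwo_cube_mem_I12 k n a b c d e))
      (reesT_mem (jThreeTwo k n a b c d e ^ 2) (jThreeTwo_sq_mem_I12 k n a b c d e)) rfl one_ne_zero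
  -- ### the engine
  obtain ⟨eE, heE⟩ := BlowupExit.exists_ringEquiv_subalgebra_of_coverData (I := I12 k n a b c d)
    (iTwo k n a b c d e ^ 3) (iTwo_cube_mem_I12 k n a b c d e)
    (jThreeTwo k n a b c d e ^ 2) (jThreeTwo_sq_mem_I12 k n a b c d e)
    (HomogeneousLocalization.Away (reesGrading (I12 k n a b c d))
      (reesT (iTwo k n a b c d e ^ 3) (iTwo_cube_mem_I12 k n a b c d e) *
        reesT (jThreeTwo k n a b c d e ^ 2) (jThreeTwo_sq_mem_I12 k n a b c d e)))
    β hβinj hnzd Fix hβS hgen hinv _ hgens hdict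
  refine ⟨eE, fun F => ?_⟩
  have h := heE F
  rw [RingHom.algebraMap_toAlgebra, JordanFour.awayMap_reesChartBase] at h
  rw [RingHom.comp_apply]
  exact h.trans (hβ F)

end Summit.ResolutionOfSingularities.ResolutionOfSingularities.Theorems.WildQuotientResolution.JordanFive

end
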